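import Summits.CriticalPhenomena.PercolationContinuityZ3.Theorems.Transplant.AutChartWallReduction
import Summits.CriticalPhenomena.PercolationContinuityZ3.Theorems.Transplant.CayleyLeftFramesRank
import Literature.Combinatorics.SimpleGraph.CayleyGraphFewAutomorphisms
import Mathlib.GroupTheory.Index
import Mathlib.GroupTheory.Finiteness
import HarnessLib

/-!
# The discrete wall, II: with a TORSION automorphism group NO skeleton of ANY number of types exists (frames of finite order translate by zero);
# customers by Leemann–de la Salle (EVERY finitely generated group has a Cayley graph with a discrete automorphism group): every f.g. TORSION group
# has a Cayley graph outside every skeleton node for EVERY framing group, and on such a Cayley graph of ANY f.g. group the one-type input forces `vb₁ ≥ 2`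

builds on p205010 (kernel theorem, internal audit signed; external expert review pending) — nothing in this file uses p205010; no node is assumed.
The `Customers` section is CONDITIONAL on ONE published fact, the Literature named fact
`Literature.Combinatorics.SimpleGraph.LeemannDeLaSalle2022_discreteCayleyGraph` (p403247), taken as a hypothesis (`hL`): Leemann–de la Salle, *Cayley
graphs with few automorphisms: the case of infinite groups*, Ann. Henri Lebesgue 5 (2022) 73–92, Cor. 1.3 with the sentence after it ("every finitely
generated group admits a finite degree Cayley graph whose automorphism group is discrete (equivalently has finite stabilizers)"; read from the held
copy arXiv:2010.06020, pp. 2–3); everything else is UNCONDITIONAL.  Lane `prim-bschramm`, seat `prim-bschramm-p4` gen 26 (PART C3 of `P4-GENERAL.md`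
§48.3–48.4, §48.9).  Helper file (`--supports stmt-CriticalPhenomena-4575 --as helper`).

* QUASI-TRANSITIVE SUBGROUPS (`AutDiscrete.exists_mul_mul_stabilizer`, `index_le_of_finite_orbits`, `exists_pow_mem_of_finite_orbits`,
  `isTorsion_of_finite_orbits_torsion`; graph forms `aut_isOfFinOrder_of_quasiTransitive_torsion`, `chart_range_finite_of_quasiTransitive_torsion`,
  `isEmpty_frmScaled_of_quasiTransitive_torsion`): `B = Γ·X·Stab(t)` when `Γ` has finitely many orbits (reps `X·t`) — index `≤ |X|·|Stab(t)|`, powers, torsion;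
  so the torsion no-go below holds for QUASI-transitive torsion subgroups of `Aut(G)` too (Benjamini–Schramm's setting).
* ANY NUMBER OF TYPES (`AutDiscrete.translation_eq_zero_of_isOfFinOrder`, `chart_mem_image_types_of_torsion`, `chart_range_finite_of_torsion`,
  `chart_range_finite_of_transitive_torsion`, `false_of_chart_step_of_torsion`, `false_of_frmScaled_of_aut_torsion`,
  `isEmpty_frmScaled_of_transitive_torsion`, `isEmpty_frm_of_transitive_torsion`, `isEmpty_frmScaled_cayley_of_isTorsion`): a frame of FINITE ORDER translates a
  chart by ZERO, so with a torsion automorphism group every chart framed by finitely many types has finite range — no self-map of `V` raises it by a fixed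
  non-zero vector (steps of ANY shape), and exact steps would: NO `PlanarSkeletonFrmScaled` of any number of types exists (strengthens the one-type
  statements of `AutDiscreteWall`; empties the interfaces of U_s, U, N2 and of the planners' multi-type node (M) alike).
* `exists_cayley_isEmpty_frmScaled_of_isTorsion`: `Γ` finitely generated TORSION ⟹ some finite generating `S` such that `Cay(Γ; S)` carries NO
  `PlanarSkeletonFrmScaled` at all, and every chart `Γ → ℤ²` translated by ANY transitive group of automorphisms of `Cay(Γ; S)` is constant
  (`exists_cayley_chart_const_of_isTorsion`): the torsion groups of intermediate growth (Grigorchuk, Gupta–Sidki, Nekrashevych) are outside every skeleton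
  node with translating frames on these Cayley graphs (gen 24: `Γ_L`-frames, one type; `AutDiscreteWall`: every framing group, one type, finite stabiliser as
  a hypothesis; this file: any number of types, the finite stabiliser from the literature).
* `char_eq_one_of_smul_rel`: a stabiliser-killing character kills the stabiliser of a FINITE invariant block (the step of the Trofimov reduction for
  non-discrete automorphism groups of polynomial-growth graphs; Trofimov's theorem itself is R-level).
(The `vb₁ ≥ 2` customers — every f.g. `Γ` has a Cayley graph on which the one-type input, indeed ANY skeleton, forces a finite-index `Γ₀ ≤ Γ` with a rank-two
`Γ₀ → ℤ²` — are in the sequel `AutDiscreteWallSkeleton`.)  DESIGN: this file deliberately imports `AutChartWallReduction` + `CayleyLeftFramesRank` rather than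
`AutDiscreteWall` (whose transitive index/torsion lemmas are the case `X = {1}` of the quasi-transitive ones here), so that it elaborates over built modules only.
NEAREST PRIOR ART (searched 2026-08-25): Grimmett–Li, *Self-avoiding walks and amenability*, Electron. J. Combin. 24 (2017) P4.38 = arXiv:1510.08659, Prop. 18 /
Cor. 19(b) / Thm. 6: on a Cayley graph with `Stab₁ = Π` (the finitely many generator permutations) of a TORSION group there is no `ℤ`-valued *graph height
function* (`h(γⁿ) = n·h(γ) = 0` on a finite-index subgroup, finitely many cosets ⟹ `h` bounded); in particular the Cayley graph of the Grigorchuk group on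
`{a, b, c}` has none.  The statements here are the `ℤ²`-chart form of that argument for an ARBITRARY finite stabiliser and any (quasi-)transitive torsion
subgroup, applied to the skeleton interfaces of this lane; the group theory is folklore.
[cite: GrimmettLi2017Amenability, Prop. 18, Cor. 19(b), Thm. 6] [cite: LeemannDelasalle2022, Cor. 1.3] [cite: BenjaminiSchramm1996, Conj. 4; §2 (Cayley graphs)]
-/

noncomputable section

namespace Summit.CriticalPhenomena.PercolationContinuityZ3.Theorems.Transplant

open SimpleGraph Literature.Probability.LatticeModels
open scoped Classical

namespace AutDiscrete

/-! ### Quasi-transitive subgroups: `B = A · X · Stab(t)`, index `≤ |X|·|Stab(t)|`, powers, torsion (the transitive case `X = {1}` is `AutDiscreteWall` §1–§2) -/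

section QuasiTransitive

variable {B : Type} [Group B] {V : Type} [MulAction B V] {t : V}

/-- **`B = A · X · Stab(t)`** as soon as the `B`-orbit of `t` meets only finitely many `A`-orbits, represented by `x • t`, `x ∈ X`: every `b` is `a * x * k`
with `a ∈ A`, `x ∈ X`, `k • t = t` (the transitive case is `X = {1}`, `exists_stabilizer_mul`). [folklore] -/
theorem exists_mul_mul_stabilizer (A : Subgroup B) (X : Finset B) (hX : ∀ b : B, ∃ x ∈ X, ∃ a ∈ A, a • x • t = b • t) (b : B) :
    ∃ a ∈ A, ∃ x ∈ X, ∃ k ∈ MulAction.stabilizer B t, b = a * x * k := by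
  obtain ⟨x, hx, a, ha, h⟩ := hX b
  refine ⟨a, ha, x, hx, x⁻¹ * a⁻¹ * b, ?_, by group⟩
  rw [MulAction.mem_stabilizer_iff, mul_smul, mul_smul, ← h, inv_smul_smul, inv_smul_smul]

/-- Hence `X × Stab(t)` maps ONTO the coset space `B ⧸ A` (by `(x, k) ↦ (x k)⁻¹ A`). [folklore] -/
theorem quotient_mk_surjective_of_finite_orbits (A : Subgroup B) (X : Finset B) (hX : ∀ b : B, ∃ x ∈ X, ∃ a ∈ A, a • x • t = b • t) :
    Function.Surjective (fun q : ↥X × MulAction.stabilizer B t => (QuotientGroup.mk (((q.2 : B))⁻¹ * ((q.1 : B))⁻¹) : B ⧸ A)) := by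
  intro q
  obtain ⟨c, rfl⟩ := QuotientGroup.mk_surjective q
  obtain ⟨a, ha, x, hx, k, hk, hc⟩ := exists_mul_mul_stabilizer A X hX c⁻¹
  refine ⟨(⟨x, hx⟩, ⟨k, hk⟩), ?_⟩
  show (QuotientGroup.mk (k⁻¹ * x⁻¹) : B ⧸ A) = QuotientGroup.mk c
  rw [QuotientGroup.eq, show c = k⁻¹ * x⁻¹ * a⁻¹ by rw [← inv_inv c, hc]; group, show (k⁻¹ * x⁻¹)⁻¹ * (k⁻¹ * x⁻¹ * a⁻¹) = a⁻¹ by group]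
  exact A.inv_mem ha

/-- **A subgroup with finitely many orbits on the orbit of `t` has index `≤ |X| · |Stab(t)|`** (finite stabiliser). [folklore] -/
theorem index_le_of_finite_orbits (A : Subgroup B) (X : Finset B) (hX : ∀ b : B, ∃ x ∈ X, ∃ a ∈ A, a • x • t = b • t)
    [Finite (MulAction.stabilizer B t)] : A.index ≤ X.card * Nat.card (MulAction.stabilizer B t) := by
  rw [Subgroup.index_eq_card, ← Nat.card_eq_finsetCard, ← Nat.card_prod]
  exact Nat.card_le_card_of_surjective _ (quotient_mk_surjective_of_finite_orbits A X hX)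

/-- … in particular it has FINITE index: `A.index ≠ 0`. [folklore] -/
theorem index_ne_zero_of_finite_orbits (A : Subgroup B) (X : Finset B) (hX : ∀ b : B, ∃ x ∈ X, ∃ a ∈ A, a • x • t = b • t)
    [Finite (MulAction.stabilizer B t)] : A.index ≠ 0 := by
  haveI : Finite (B ⧸ A) := Finite.of_surjective _ (quotient_mk_surjective_of_finite_orbits A X hX)
  haveI : Nonempty (B ⧸ A) := ⟨QuotientGroup.mk 1⟩
  rw [Subgroup.index_eq_card]
  exact Nat.card_pos.ne'

/-- **Every element of `B` has a power in such a subgroup**, of exponent `≤ |X| · |Stab(t)|`. [folklore] -/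
theorem exists_pow_mem_of_finite_orbits (A : Subgroup B) (X : Finset B) (hX : ∀ b : B, ∃ x ∈ X, ∃ a ∈ A, a • x • t = b • t)
    [Finite (MulAction.stabilizer B t)] (b : B) : ∃ n : ℕ, 0 < n ∧ n ≤ X.card * Nat.card (MulAction.stabilizer B t) ∧ b ^ n ∈ A := by
  obtain ⟨n, hn, hle, hmem⟩ := A.exists_pow_mem_of_index_ne_zero (index_ne_zero_of_finite_orbits A X hX) b
  exact ⟨n, hn, hle.trans (index_le_of_finite_orbits A X hX), hmem⟩

/-- **`B` is a torsion group** when it acts with a finite stabiliser and contains a TORSION subgroup with finitely many orbits on the orbit of `t`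
(transitive case: `isTorsion_of_transitive_torsion`). [folklore] -/
theorem isTorsion_of_finite_orbits_torsion (Γ : Subgroup B) (X : Finset B) (hX : ∀ b : B, ∃ x ∈ X, ∃ γ ∈ Γ, γ • x • t = b • t)
    (htor : ∀ γ ∈ Γ, IsOfFinOrder γ) [Finite (MulAction.stabilizer B t)] : Monoid.IsTorsion B := fun b => by
  obtain ⟨n, hn, -, hmem⟩ := exists_pow_mem_of_finite_orbits Γ X hX b
  exact (htor _ hmem).of_pow hn.ne'

end QuasiTransitive

/-! ### Any number of types: with a TORSION automorphism group every framed chart has FINITE range — no skeleton of the ladder at all -/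

section MultiType

variable {V : Type} {G : SimpleGraph V}

/-- Powers of a graph automorphism act by iteration: `(α ^ k) w = α^[k] w`. [folklore] -/
theorem relIso_pow_apply (α : G ≃g G) (k : ℕ) (w : V) : (α ^ k) w = (⇑α)^[k] w := by
  induction k generalizing w with
  | zero => rfl
  | succ k ih => rw [pow_succ, RelIso.coe_mul, Function.comp_apply, ih, Function.iterate_succ_apply]

/-- **A frame of FINITE ORDER translates the chart by zero**: if `φ (α w) = φ w + d` for all `w` and `α` has finite order, then `d = 0`
(`φ w = φ (αⁿ w) = φ w + n • d` in the torsion-free `ℤ²`; the `ℤ`-valued Cayley case is the first half of Grimmett–Li's Cor. 19(b)).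
[cite: GrimmettLi2017Amenability, Cor. 19(b)] -/
theorem translation_eq_zero_of_isOfFinOrder (α : G ≃g G) (hα : IsOfFinOrder α) (φ : V → Site 2) (d : Site 2)
    (h : ∀ w, φ (α w) = φ w + d) (w₀ : V) : d = 0 := by
  obtain ⟨n, hn, hαn⟩ := isOfFinOrder_iff_pow_eq_one.1 hα
  have hiter : ∀ k : ℕ, φ ((⇑α)^[k] w₀) = φ w₀ + k • d := by
    intro k
    induction k with
    | zero => rw [Function.iterate_zero, id, zero_smul, add_zero]
    | succ k ih => rw [Function.iterate_succ_apply', h, ih, add_assoc, ← succ_nsmul]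
  have hk := hiter n
  rw [← relIso_pow_apply, hαn, RelIso.coe_one, id, left_eq_add] at hk
  funext i
  have hi : (n : ℤ) * d i = 0 := by
    have := congrFun hk i
    rw [Pi.smul_apply, nsmul_eq_mul, Pi.zero_apply] at this
    exact this
  rcases mul_eq_zero.1 hi with h0 | h0
  · exact absurd (by exact_mod_cast h0 : n = 0) hn.ne'
  · exact h0

/-- **With a torsion automorphism group, a chart framed by finitely many types takes only the values of its base vertices** — whatever the number of types:
every frame has finite order, so it translates by zero, so `φ v = φ t_v` (Grimmett–Li Cor. 19(b): "`h` is bounded", for `ℤ`-valued height functions on Cayley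
graphs with `Stab₁ = Π`). [cite: GrimmettLi2017Amenability, Prop. 18(c), Cor. 19(b)] [cite: BenjaminiSchramm1996, §2 (almost transitive graphs)] -/
theorem chart_mem_image_types_of_torsion (htor : ∀ α : G ≃g G, IsOfFinOrder α) (φ : V → Site 2) (T : Finset V)
    (hframe : ∀ v : V, ∃ t ∈ T, ∃ α : G ≃g G, α t = v ∧ ∀ w, φ (α w) = φ w + (φ v - φ t)) (v : V) : φ v ∈ T.image φ := by
  obtain ⟨t, ht, α, -, hα⟩ := hframe v
  have hd := translation_eq_zero_of_isOfFinOrder α (htor α) φ (φ v - φ t) hα v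
  rw [sub_eq_zero] at hd
  rw [hd]
  exact Finset.mem_image_of_mem φ ht

/-- Hence **with a torsion automorphism group every chart framed by finitely many types has FINITE RANGE** — so no chart-and-frames interface with
unbounded steps of ANY kind (single-edge steps, scaled steps, steps along paths) can live on such a graph. [cite: GrimmettLi2017Amenability, Cor. 19(b)]
[cite: BenjaminiSchramm1996, §2 (almost transitive graphs)] -/
theorem chart_range_finite_of_torsion (htor : ∀ α : G ≃g G, IsOfFinOrder α) (φ : V → Site 2) (T : Finset V)
    (hframe : ∀ v : V, ∃ t ∈ T, ∃ α : G ≃g G, α t = v ∧ ∀ w, φ (α w) = φ w + (φ v - φ t)) : (Set.range φ).Finite :=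
  (T.image φ).finite_toSet.subset (by rintro _ ⟨v, rfl⟩; exact chart_mem_image_types_of_torsion htor φ T hframe v)

/-- **`Aut(G)` is torsion, QUASI-TRANSITIVE FORM**: some vertex stabiliser in `Aut(G)` is finite and some QUASI-transitive subgroup `Γ ≤ Aut(G)` (finitely many
orbits on `V`, met by the finite set `R`) is torsion ⟹ every automorphism of `G` has finite order (`Γ` has index `≤ |R| · |Stab(t)|` in `Aut(G)`).
[cite: BenjaminiSchramm1996, §2 (almost transitive graphs)] [cite: LeemannDelasalle2022, Cor. 1.3] -/
theorem aut_isOfFinOrder_of_quasiTransitive_torsion (t : V) (hfin : {α : G ≃g G | α t = t}.Finite) (Γ : Subgroup (G ≃g G)) (R : Finset V)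
    (hR : ∀ v : V, ∃ r ∈ R, ∃ γ ∈ Γ, γ r = v) (htor : ∀ γ ∈ Γ, IsOfFinOrder γ) (α : G ≃g G) : IsOfFinOrder α := by
  letI : MulAction (G ≃g G) V := AutChart.autMulAction G
  haveI : Finite (MulAction.stabilizer (G ≃g G) t) := by
    have e : (MulAction.stabilizer (G ≃g G) t : Set (G ≃g G)) = {α : G ≃g G | α t = t} := by
      ext α; exact MulAction.mem_stabilizer_iff
    exact (e ▸ hfin).to_subtype
  -- representatives INSIDE the `Aut(G)`-orbit of `t`: for `r` reachable from `t` pick `x r` with `x r t = r`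
  choose! x hx using fun (r : V) (h : ∃ β : G ≃g G, β t = r) => h
  refine isTorsion_of_finite_orbits_torsion (t := t) Γ (R.image x) (fun β => ?_) htor α
  obtain ⟨r, hr, γ, hγ, hγr⟩ := hR (β t)
  have hreach : ∃ β' : G ≃g G, β' t = r := ⟨γ⁻¹ * β, by rw [RelIso.coe_mul, Function.comp_apply, ← hγr, RelIso.inv_apply_self]⟩
  exact ⟨x r, Finset.mem_image_of_mem x hr, γ, hγ, by change γ ((x r) t) = β t; rw [hx r hreach, hγr]⟩

/-- GRAPH FORM: a finite vertex stabiliser in `Aut(G)` and a transitive TORSION subgroup `Γ ≤ Aut(G)` ⟹ every chart `V → ℤ²` framed by finitely many types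
(frames = automorphisms translating the chart, from ANY part of `Aut(G)`) has finite range. [cite: BenjaminiSchramm1996, §2 (almost transitive graphs)]
[cite: LeemannDelasalle2022, Cor. 1.3] -/
theorem chart_range_finite_of_transitive_torsion (t : V) (hfin : {α : G ≃g G | α t = t}.Finite) (Γ : Subgroup (G ≃g G))
    (htr : ∀ v : V, ∃ γ ∈ Γ, γ t = v) (htor : ∀ γ ∈ Γ, IsOfFinOrder γ) (φ : V → Site 2) (T : Finset V)
    (hframe : ∀ v : V, ∃ t ∈ T, ∃ α : G ≃g G, α t = v ∧ ∀ w, φ (α w) = φ w + (φ v - φ t)) : (Set.range φ).Finite :=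
  chart_range_finite_of_torsion (aut_isOfFinOrder_of_quasiTransitive_torsion t hfin Γ {t}
    (fun v => by obtain ⟨γ, hγ, h⟩ := htr v; exact ⟨t, Finset.mem_singleton_self t, γ, hγ, h⟩) htor) φ T hframe

/-- **No unbounded steps on a chart of finite range**: with a torsion automorphism group, a chart framed by finitely many types admits NO self-map of the
vertex set raising the chart by a fixed non-zero vector — single-edge steps, scaled steps `+N eᵢ`, quasi-steps along paths, ANY number of types alike (the orbit
`k ↦ φ (next^[k] v) = φ v + k • d` would be injective inside the finite set `φ(T)`). [cite: BenjaminiSchramm1996, §2 (almost transitive graphs)] -/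
theorem false_of_chart_step_of_torsion (htor : ∀ α : G ≃g G, IsOfFinOrder α) (φ : V → Site 2) (T : Finset V)
    (hframe : ∀ v : V, ∃ t ∈ T, ∃ α : G ≃g G, α t = v ∧ ∀ w, φ (α w) = φ w + (φ v - φ t))
    (next : V → V) (d : Site 2) (hd : d ≠ 0) (hstep : ∀ v, φ (next v) = φ v + d) (v : V) : False := by
  obtain ⟨i, hi⟩ : ∃ i, d i ≠ 0 := Function.ne_iff.1 hd
  have hiter : ∀ k : ℕ, φ (next^[k] v) = φ v + k • d := by
    intro k
    induction k with
    | zero => rw [Function.iterate_zero, id, zero_smul, add_zero]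
    | succ k ih => rw [Function.iterate_succ_apply', hstep, ih, add_assoc, ← succ_nsmul]
  have hmem : ∀ k : ℕ, φ (next^[k] v) ∈ T.image φ := fun k => chart_mem_image_types_of_torsion htor φ T hframe _
  have hinj : Function.Injective fun k : ℕ => (⟨φ (next^[k] v), hmem k⟩ : ↥(T.image φ)) := by
    intro k l hkl
    have h := congrArg (fun x : ↥(T.image φ) => (x : Site 2) i) hkl
    simp only [hiter, Pi.add_apply, Pi.smul_apply, add_right_inj] at h
    rw [nsmul_eq_mul, nsmul_eq_mul] at h
    exact_mod_cast mul_right_cancel₀ hi h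
  exact not_injective_infinite_finite _ hinj

/-- **NO `PlanarSkeletonFrmScaled` OF ANY NUMBER OF TYPES on a graph with a torsion automorphism group** (its exact steps `+N e₀` are a self-map raising the
chart by `N e₀ ≠ 0`).  Through the forgetful maps this empties every interface of the ladder with translating frames (`PlanarSkeletonFrm(From)`, `Neg(From)`, `Sign`
all map to `FrmScaled`), for the one-type AND the multi-type nodes alike. [cite: KozmaNitzan2024, §4 p. 16 (Lemma 8)] [cite: BenjaminiSchramm1996, Conj. 4; §2] -/
theorem false_of_frmScaled_of_aut_torsion [G.LocallyFinite] (htor : ∀ α : G ≃g G, IsOfFinOrder α) (Φ : PlanarSkeletonFrmScaled G) (v : V) :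
    False := by
  choose next hnext using fun w : V => Φ.step w 0 1
  have hN : (Φ.N : ℤ) ≠ 0 := by have := Φ.one_le_N; omega
  refine false_of_chart_step_of_torsion htor Φ.φ Φ.types Φ.frame next (Pi.single 0 ((Φ.N : ℤ) * ((1 : ℤˣ) : ℤ))) ?_
    (fun w => (hnext w).2) v
  intro h
  have h0 := congrFun h 0
  rw [Pi.single_eq_same, Pi.zero_apply, Units.val_one, mul_one] at h0
  exact hN h0

/-- **THE TORSION NO-GO FOR EVERY SKELETON NODE, ANY NUMBER OF TYPES**: a finite vertex stabiliser in `Aut(G)` and a transitive TORSION subgroup leave NO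
`PlanarSkeletonFrmScaled` on `G` at all (one type = the open node `U_s`; several types = the planners' multi-type node (M)) — strengthening
`AutDiscrete.no_oneType_skeleton_of_torsion`. [cite: BenjaminiSchramm1996, Conj. 4; §2] [cite: LeemannDelasalle2022, Cor. 1.3] -/
theorem isEmpty_frmScaled_of_transitive_torsion [G.LocallyFinite] (t : V) (hfin : {α : G ≃g G | α t = t}.Finite) (Γ : Subgroup (G ≃g G))
    (htr : ∀ v : V, ∃ γ ∈ Γ, γ t = v) (htor : ∀ γ ∈ Γ, IsOfFinOrder γ) : IsEmpty (PlanarSkeletonFrmScaled G) :=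
  ⟨fun Φ => false_of_frmScaled_of_aut_torsion (aut_isOfFinOrder_of_quasiTransitive_torsion t hfin Γ {t}
    (fun v => by obtain ⟨γ, hγ, h⟩ := htr v; exact ⟨t, Finset.mem_singleton_self t, γ, hγ, h⟩) htor) Φ t⟩

/-- … nor a `PlanarSkeletonFrmFrom` or a `PlanarSkeletonFrm` (interfaces of the open nodes U and N2, any number of types). [cite: BenjaminiSchramm1996, Conj. 4] -/
theorem isEmpty_frm_of_transitive_torsion [G.LocallyFinite] (t : V) (hfin : {α : G ≃g G | α t = t}.Finite) (Γ : Subgroup (G ≃g G))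
    (htr : ∀ v : V, ∃ γ ∈ Γ, γ t = v) (htor : ∀ γ ∈ Γ, IsOfFinOrder γ) :
    IsEmpty (PlanarSkeletonFrmFrom G) ∧ IsEmpty (PlanarSkeletonFrm G) :=
  have h := isEmpty_frmScaled_of_transitive_torsion t hfin Γ htr htor
  ⟨⟨fun Φ => h.false Φ.toFrmScaled⟩, ⟨fun Φ => h.false Φ.toFrmFrom.toFrmScaled⟩⟩

/-- **QUASI-TRANSITIVE TORSION NO-GO, ANY NUMBER OF TYPES**: a finite vertex stabiliser in `Aut(G)` and a quasi-transitive TORSION subgroup leave every chart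
`V → ℤ²` framed by finitely many types with FINITE range … [cite: BenjaminiSchramm1996, Conj. 4; §2 (almost transitive graphs)] -/
theorem chart_range_finite_of_quasiTransitive_torsion (t : V) (hfin : {α : G ≃g G | α t = t}.Finite) (Γ : Subgroup (G ≃g G)) (R : Finset V)
    (hR : ∀ v : V, ∃ r ∈ R, ∃ γ ∈ Γ, γ r = v) (htor : ∀ γ ∈ Γ, IsOfFinOrder γ) (φ : V → Site 2) (T : Finset V)
    (hframe : ∀ v : V, ∃ t ∈ T, ∃ α : G ≃g G, α t = v ∧ ∀ w, φ (α w) = φ w + (φ v - φ t)) : (Set.range φ).Finite :=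
  chart_range_finite_of_torsion (aut_isOfFinOrder_of_quasiTransitive_torsion t hfin Γ R hR htor) φ T hframe

/-- … and NO `PlanarSkeletonFrmScaled` (nor `FrmFrom`, nor `Frm`) of any number of types. [cite: BenjaminiSchramm1996, Conj. 4; §2 (almost transitive graphs)] -/
theorem isEmpty_frmScaled_of_quasiTransitive_torsion [G.LocallyFinite] (t : V) (hfin : {α : G ≃g G | α t = t}.Finite) (Γ : Subgroup (G ≃g G))
    (R : Finset V) (hR : ∀ v : V, ∃ r ∈ R, ∃ γ ∈ Γ, γ r = v) (htor : ∀ γ ∈ Γ, IsOfFinOrder γ) :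
    IsEmpty (PlanarSkeletonFrmScaled G) ∧ IsEmpty (PlanarSkeletonFrmFrom G) ∧ IsEmpty (PlanarSkeletonFrm G) :=
  have h : IsEmpty (PlanarSkeletonFrmScaled G) :=
    ⟨fun Φ => false_of_frmScaled_of_aut_torsion (aut_isOfFinOrder_of_quasiTransitive_torsion t hfin Γ R hR htor) Φ t⟩
  ⟨h, ⟨fun Φ => h.false Φ.toFrmScaled⟩, ⟨fun Φ => h.false Φ.toFrmFrom.toFrmScaled⟩⟩

/-- **CAYLEY FORM**: `Γ` torsion, `S` finite, the stabiliser of `1` in `Aut(Cay(Γ; S))` finite ⟹ `Cay(Γ; S)` carries NO `PlanarSkeletonFrmScaled` of any number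
of types (compare Grimmett–Li Thm. 6: the Cayley graph of the Grigorchuk group on `{a, b, c}` has `Stab₁ = Π` and no graph height function).
[cite: GrimmettLi2017Amenability, Cor. 19(b), Thm. 6] [cite: BenjaminiSchramm1996, Conj. 4; §2 (Cayley graphs)] [cite: LeemannDelasalle2022, Cor. 1.3] -/
theorem isEmpty_frmScaled_cayley_of_isTorsion {Γ : Type} [Group Γ] (S : Finset Γ) (hΓ : Monoid.IsTorsion Γ)
    (hfin : {α : mulCayley (S : Set Γ) ≃g mulCayley (S : Set Γ) | α 1 = 1}.Finite) : IsEmpty (PlanarSkeletonFrmScaled (mulCayley (S : Set Γ))) := by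
  let L : Γ →* (mulCayley (S : Set Γ) ≃g mulCayley (S : Set Γ)) :=
    { toFun := leftMulIso S, map_one' := RelIso.ext fun w => one_mul w, map_mul' := fun g h => RelIso.ext fun w => mul_assoc g h w }
  exact isEmpty_frmScaled_of_transitive_torsion 1 hfin L.range (fun v => ⟨leftMulIso S v, ⟨v, rfl⟩, mul_one v⟩)
    (by rintro γ ⟨g, rfl⟩; exact L.isOfFinOrder (hΓ g))

end MultiType

section Customers

variable {Γ : Type} [Group Γ]

/-- **Every finitely generated TORSION group has a Cayley graph WITHOUT ANY `PlanarSkeletonFrmScaled` — any number of types** (so outside the open one-type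
node `U_s`, the open nodes U / N2, AND the planners' multi-type node (M)), whatever the framing group — conditional on Leemann–de la Salle's Cor. 1.3 (`hL`),
by `isEmpty_frmScaled_cayley_of_isTorsion`.  Customers: the torsion groups of intermediate growth of the class map's residual (c).
[cite: LeemannDelasalle2022, Cor. 1.3] [cite: BenjaminiSchramm1996, Conj. 4; §2 (Cayley graphs)] -/
theorem exists_cayley_isEmpty_frmScaled_of_isTorsion (hL : Literature.Combinatorics.SimpleGraph.LeemannDeLaSalle2022_discreteCayleyGraph) [Group.FG Γ]
    (hΓ : Monoid.IsTorsion Γ) :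
    ∃ S : Finset Γ, Subgroup.closure (↑S : Set Γ) = ⊤ ∧ IsEmpty (PlanarSkeletonFrmScaled (mulCayley (↑S : Set Γ))) := by
  obtain ⟨S, hS, hfin⟩ := hL Γ ‹Group.FG Γ›
  exact ⟨S, hS, isEmpty_frmScaled_cayley_of_isTorsion S hΓ hfin⟩

/-- … and on that Cayley graph **every chart `Γ → ℤ²` translated by ANY transitive group of automorphisms is constant** — the hypotheses of
`AutChart.criticalContinuity_of_autSubgroup` fail for every `A`. [cite: LeemannDelasalle2022, Cor. 1.3] [cite: BenjaminiSchramm1996, Conj. 4; §2] -/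
theorem exists_cayley_chart_const_of_isTorsion (hL : Literature.Combinatorics.SimpleGraph.LeemannDeLaSalle2022_discreteCayleyGraph) [Group.FG Γ]
    (hΓ : Monoid.IsTorsion Γ) :
    ∃ S : Finset Γ, Subgroup.closure (↑S : Set Γ) = ⊤ ∧
      ∀ (A : Subgroup (mulCayley (↑S : Set Γ) ≃g mulCayley (↑S : Set Γ))), (∀ v : Γ, ∃ α ∈ A, α 1 = v) →
        ∀ φ : Γ → Site 2, (∀ α ∈ A, ∀ w : Γ, φ (α w) = φ w + (φ (α 1) - φ 1)) → ∀ x : Γ, φ x = φ 1 := by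
  obtain ⟨S, hS, hfin⟩ := hL Γ ‹Group.FG Γ›
  refine ⟨S, hS, fun A htrA φ hφ x => ?_⟩
  let L : Γ →* (mulCayley (S : Set Γ) ≃g mulCayley (S : Set Γ)) :=
    { toFun := leftMulIso S, map_one' := RelIso.ext fun w => one_mul w, map_mul' := fun g h => RelIso.ext fun w => mul_assoc g h w }
  have htorAut : ∀ α : mulCayley (S : Set Γ) ≃g mulCayley (S : Set Γ), IsOfFinOrder α :=
    aut_isOfFinOrder_of_quasiTransitive_torsion (1 : Γ) hfin L.range {1}
      (fun v => ⟨1, Finset.mem_singleton_self _, leftMulIso S v, ⟨v, rfl⟩, mul_one v⟩) (by rintro γ ⟨g, rfl⟩; exact L.isOfFinOrder (hΓ g))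
  obtain ⟨α, hα, rfl⟩ := htrA x
  have h0 := translation_eq_zero_of_isOfFinOrder α (htorAut α) φ (φ (α 1) - φ 1) (hφ α hα) 1
  exact sub_eq_zero.1 h0

end Customers

/-! ### Blocks: a stabiliser-killing character kills the stabiliser of a FINITE block (the one step of the Trofimov reduction for non-discrete groups) -/

section Blocks

variable {B : Type} [Group B] {V : Type} [MulAction B V] {t : V}

/-- **A character killing `Stab_A(t)` kills the stabiliser of any finite `A`-invariant block through `t`**: if `σ` is an equivalence relation on `V` preserved by
the action and the class of `t` is finite, then every `a ∈ A` with `a • t ∼ t` has `c a = 1` — its powers move `t` inside the finite class, so two of them agree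
and a positive power of `a` fixes `t`.  This is the step by which, for a vertex-transitive graph of polynomial growth with NON-discrete automorphism group, the
wall of `G` reduces to the wall of the discrete quotient action on the blocks of Trofimov's system of imprimitivity (Trofimov's theorem itself is not in the tree).
[cite: BenjaminiSchramm1996, §2 (almost transitive graphs; quotient graphs)] -/
theorem char_eq_one_of_smul_rel (r : V → V → Prop) (hsymm : ∀ v w, r v w → r w v) (htrans : ∀ u v w, r u v → r v w → r u w)
    (hinv : ∀ (b : B) (v w : V), r v w → r (b • v) (b • w)) (hfin : {v : V | r v t}.Finite) {A : Subgroup B} (c : A →* Multiplicative (Site 2))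
    (hstab : ∀ h : A, (h : B) • t = t → c h = 1) (a : A) (ha : r ((a : B) • t) t) : c a = 1 := by
  -- every power of `a` moves `t` inside the class of `t`
  have hrefl : r t t := htrans t ((a : B) • t) t (hsymm _ _ ha) ha
  have hpow : ∀ n : ℕ, r (((a : B) ^ n) • t) t := by
    intro n
    induction n with
    | zero => rwa [pow_zero, one_smul]
    | succ n ih =>
      rw [pow_succ', mul_smul]
      exact htrans _ _ _ (hinv (a : B) _ _ ih) ha
  -- two powers agree (the class is finite)
  have hnotinj : ¬ Function.Injective (fun n : ℕ => (⟨((a : B) ^ n) • t, hpow n⟩ : {v : V | r v t})) := by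
    intro hinj
    haveI : Finite {v : V | r v t} := hfin.to_subtype
    exact not_injective_infinite_finite _ hinj
  obtain ⟨i, j, hij, hne⟩ : ∃ i j : ℕ, ((a : B) ^ i) • t = ((a : B) ^ j) • t ∧ i ≠ j := by
    simp only [Function.Injective, not_forall] at hnotinj
    obtain ⟨i, j, h, hne⟩ := hnotinj
    exact ⟨i, j, congrArg Subtype.val h, hne⟩
  -- a positive power of `a` fixes `t`, so `c a` is torsion in the torsion-free `ℤ²`
  have key : ∀ i j : ℕ, i < j → ((a : B) ^ i) • t = ((a : B) ^ j) • t → c a = 1 := by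
    intro i j hlt he
    have h2 : ((a : B) ^ i) • (((a : B) ^ (j - i)) • t) = ((a : B) ^ i) • t := by
      rw [← mul_smul, ← pow_add, Nat.add_sub_cancel' hlt.le]
      exact he.symm
    have hfix : ((a : B) ^ (j - i)) • t = t := MulAction.injective _ h2
    have h1 : c (a ^ (j - i)) = 1 := hstab (a ^ (j - i)) (by rw [Subgroup.coe_pow]; exact hfix)
    have hn : 0 < j - i := Nat.sub_pos_of_lt hlt
    have h : (j - i) • Multiplicative.toAdd (c a) = 0 := by
      rw [← toAdd_pow, ← map_pow, h1, toAdd_one]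
    rw [← ofAdd_toAdd (c a), ← ofAdd_zero]
    congr 1
    funext k
    have hk : ((j - i : ℕ) : ℤ) * Multiplicative.toAdd (c a) k = 0 := by
      have := congrFun h k
      rwa [Pi.smul_apply, nsmul_eq_mul] at this
    rcases mul_eq_zero.1 hk with h0 | h0
    · exact absurd (by exact_mod_cast h0 : j - i = 0) hn.ne'
    · exact h0
  rcases Nat.lt_or_gt_of_ne hne with hlt | hlt
  · exact key i j hlt hij
  · exact key j i hlt hij.symm

end Blocks

end AutDiscrete

end Summit.CriticalPhenomena.PercolationContinuityZ3.Theorems.Transplant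

end
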